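import Mathlib
import Literature.Computability.MetaComplexity.ResLin
import Literature.Computability.MetaComplexity.ResLinProofs

/-!
# `LadderResidual` (stmt-PneNP-18933, route PneNP/ReslinSizeFromWidth) — negative-side lemmas (1/3):
Res(⊕) refutations download an unsatisfiable sub-CNF

A dag-like Res(⊕) derivation from `φ` (semantic weakening from ONE earlier line,
`IsResLinDerivation`) is already a derivation from the sub-CNF of the clauses of `φ` it actually
downloads — those whose translations occur among its lines (`isResLinDerivation_restrict_downloaded`);
with the tree's soundness theorem (`not_satisfiable_of_isResLinRefutation_holds`) a refutation
therefore downloads an unsatisfiable sub-CNF (`exists_downloaded_clause_eval_false`), and for a CNF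
made of *critical* clauses (each falsified by an assignment satisfying all the others, i.e. minimally
unsatisfiable) it downloads every clause, the translations being pairwise distinct:
`card_le_length_of_critical`, the clause-counting lower bound used in `AntecedentHolds.lean` to prove
the antecedent of `LadderResidual` outright.

Refuter seat refuter-rattack-stmt-PneNP-18933-0 (crux-attack at birth), 2026-08-17.
-/

set_option linter.dupNamespace false -- `Summit.PneNP.PneNP.…`: summit = sub-problem (D-0017)

namespace Summit.PneNP.PneNP.Theorems.LadderResidual.Negative

open Literature.Computability.Complexity Literature.Computability.MetaComplexity

/-- **Restriction to the downloaded clauses.** A Res(⊕) derivation from `φ` is a derivation from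
the sub-CNF of the clauses of `φ` whose translations occur among its lines (only the `initial`
rule mentions `φ`). [cite: ItsyksonSokolov2020, §2 (rules of Res(⊕))] -/
theorem isResLinDerivation_restrict_downloaded {φ : CNF ℕ} {π : List ResLinLine}
    (hπ : IsResLinDerivation φ π) :
    IsResLinDerivation
      (φ.filter fun c => decide (Clause.toLinClause c ∈ π.map ResLinLine.clause)) π := by
  intro k hk
  have hv := hπ k hk
  rcases hr : (π[k]'hk).rule with _ | ⟨i, j, f⟩ | i
  · simp only [IsValidResLinLine, hr] at hv ⊢
    obtain ⟨c, hc, hcl⟩ := hv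
    refine ⟨c, ?_, hcl⟩
    rw [List.mem_filter]
    exact ⟨hc, decide_eq_true (List.mem_map.2 ⟨π[k], List.getElem_mem hk, hcl⟩)⟩
  · simp only [IsValidResLinLine, hr] at hv ⊢
    exact hv
  · simp only [IsValidResLinLine, hr] at hv ⊢
    exact hv

/-- **A refutation downloads an unsatisfiable sub-CNF.** Under every assignment some clause of `φ`
whose translation occurs in the refutation is false. [cite: ItsyksonSokolov2020, §2 (soundness of Res(⊕))] -/
theorem exists_downloaded_clause_eval_false {φ : CNF ℕ} {π : List ResLinLine}
    (hπ : IsResLinRefutation φ π) (σ : ℕ → Bool) :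
    ∃ c ∈ φ, Clause.toLinClause c ∈ π.map ResLinLine.clause ∧ Clause.eval σ c = false := by
  have href : IsResLinRefutation
      (φ.filter fun c => decide (Clause.toLinClause c ∈ π.map ResLinLine.clause)) π :=
    ⟨isResLinDerivation_restrict_downloaded hπ.1, hπ.2⟩
  have hns := not_satisfiable_of_isResLinRefutation_holds href
  by_contra hall
  refine hns ⟨σ, (CNF.eval_eq_true_iff _ σ).2 fun c hc => ?_⟩
  rw [List.mem_filter, decide_eq_true_eq] at hc
  by_contra hct
  exact hall ⟨c, hc.1, hc.2, eq_false_of_ne_true hct⟩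

/-- **Counting.** If `φ` consists of clauses `cl i` each of which is *critical* — the assignment
`crit i` falsifies `cl i` and satisfies every `cl j`, `j ≠ i` (so `φ` is minimally unsatisfiable
once unsatisfiable) — then every Res(⊕) refutation of `φ` has at least `card ι` lines: it must
download every clause, and critical clauses have pairwise distinct translations. [folklore] -/
theorem card_le_length_of_critical {ι : Type*} [Fintype ι] {φ : CNF ℕ} (cl : ι → Clause ℕ)
    (hφ : ∀ c ∈ φ, ∃ i, c = cl i) (crit : ι → ℕ → Bool)
    (hself : ∀ i, Clause.eval (crit i) (cl i) = false)
    (hother : ∀ i j, i ≠ j → Clause.eval (crit i) (cl j) = true)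
    {π : List ResLinLine} (hπ : IsResLinRefutation φ π) :
    Fintype.card ι ≤ π.length := by
  classical
  -- every translated clause occurs among the lines
  have hocc : ∀ i, Clause.toLinClause (cl i) ∈ π.map ResLinLine.clause := by
    intro i
    obtain ⟨c, hc, hmem, hfalse⟩ := exists_downloaded_clause_eval_false hπ (crit i)
    obtain ⟨j, rfl⟩ := hφ c hc
    have hji : j = i := by
      by_contra hji
      have htrue := hother i j (Ne.symm hji)
      rw [htrue] at hfalse
      exact Bool.noConfusion hfalse
    subst hji
    exact hmem
  -- critical clauses have pairwise distinct translations (they differ semantically)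
  have hinj : Function.Injective fun i => Clause.toLinClause (cl i) := by
    intro i j hij
    by_contra hne
    have e1 : (Clause.toLinClause (cl i)).eval (crit i) =
        (Clause.toLinClause (cl j)).eval (crit i) := by
      simp only at hij
      rw [hij]
    rw [eval_toLinClause, eval_toLinClause] at e1
    have h1 : Clause.eval (crit i) (cl i) = false := hself i
    have h2 : Clause.eval (crit i) (cl j) = true := hother i j hne
    simp only [Clause.eval] at h1 h2
    rw [h1, h2] at e1
    exact Bool.noConfusion e1
  calc Fintype.card ι
      = (Finset.univ.image fun i => Clause.toLinClause (cl i)).card := by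
        rw [Finset.card_image_of_injective _ hinj, Finset.card_univ]
    _ ≤ (π.map ResLinLine.clause).toFinset.card := by
        apply Finset.card_le_card
        intro x hx
        obtain ⟨i, -, rfl⟩ := Finset.mem_image.1 hx
        exact List.mem_toFinset.2 (hocc i)
    _ ≤ (π.map ResLinLine.clause).length := List.toFinset_card_le _
    _ = π.length := List.length_map _

end Summit.PneNP.PneNP.Theorems.LadderResidual.Negative
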